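import Literature.NumberTheory.LFunctions.MoebiusAutomaticRegularRep
import Literature.NumberTheory.LFunctions.MoebiusAutomaticSyncTwist
import Literature.NumberTheory.LFunctions.MoebiusAutomaticRootTransfer
import Literature.NumberTheory.LFunctions.AutomaticSequencePowTransducer5
import Literature.NumberTheory.LFunctions.MoebiusAutomaticPowReduction
import HarnessLib

/-!
# Müllner's theorem from the matrix Mauduit–Rivat estimate: Prop. 3.2 at a zero-stable root and the assembly of Thm. 1.2 (Müllner 2017, §4.3; proved modulo `MatrixMauduitRivat`)

Everything in this file is PROVED; the only analytic input that is not proved in the tree enters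
as the HYPOTHESIS `MatrixMauduitRivat k` (Müllner's Thm. 4.4 in operator form,
`MoebiusAutomaticRegularRep.lean`). The file carries out §4.3 of C. Müllner, *Automatic sequences
fulfill the Sarnak conjecture* (Duke Math. J. 166 (2017) = arXiv:1602.03042) — the proof of
Prop. 3.2 — for a base-`k` automaton with `d = k₀ = 1` (Prop. 2.25), a ZERO-STABLE state `M`
of its naturally induced transducer and the good labelling `ρ = goodLabel M` (Lemma 2.14), and
then assembles the named fact `Literature.NumberTheory.LFunctions.mullner_moebius_automatic`
(Thm. 1.2, case `ξ = a`) from `∀ k ≥ 2, MatrixMauduitRivat k`: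

* `exists_apSum_le_of_expSum` — residue classes from `θ`-uniform exponential sums (vector form
  of the expansion of `[n ≡ c (q)]` into additive characters, as in §4.3);
* `MinImage.exists_residue_constants` — `s₀(T̄(M, w)) ≡ [w]_k + c(δ(M,w)) (mod d')` for all digit
  words `w` (Thm. 2.16 with `k₀ = 1`, the constants coming from the return paths of the good
  labelling);
* `MinImage.exists_badSum_le` — **the `D_ℓ`-part (Lemma 4.11)**: for `b` in the bad subspace
  (the `D_ℓ`-isotypic part of the regular representation) the matrix coefficients
  `⟨u, R(T̄(M,(n)_k)) b⟩` are `e(ℓ n/d')` times a function of the end state, and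
  `∑_{n<x, n≡c (q)} μ(n) ⟨u, R(T̄(M,(n)_k)) b⟩ = o(x)` by `MoebiusAutomaticSyncTwist.lean`;
* `MinImage.exists_goodSum_le` — the other representations: Thm. 4.4 (`MatrixMauduitRivat`) with
  Lemma 4.10 and Thm. 4.5 (`exists_expSum_good_le`), then residue classes;
* **`MinImage.exists_rootSumρ_le` — Prop. 3.2 at the root, relabelled form**: assuming
  `MatrixMauduitRivat k`, for every output `π`, modulus `q ≥ 1`, residue `c` and `ε > 0`,
  `|∑_{n<x, n≡c (q), T̄(M,(n)_k) = π} μ(n)| ≤ ε x` for all large `x` — via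
  `[g = π] = ⟨δ_π, R(g) δ_1⟩` and the orthogonal decomposition `δ_1 = y₀ + b` into a good and a
  bad vector (Müllner: "For `D = D_ℓ` Lemma 4.11 gives the result. Suppose from now on
  `D ≠ D_ℓ` … we can apply Thm. 4.4");
* `powδ_digitRestrict` — the power automaton only reads digits;
* **`mullner_moebius_automatic_of_matrixMauduitRivat`** — the assembly: the reduction to
  zero-stable roots of the final components of a power automaton
  (`mullner_moebius_automatic_of_rootAPEstimate_zeroStable`, Prop. 3.3 + Prop. 2.25), with the
  exponent `p = |σ|! · d(A) k₀(A)` so that every component has `d = k₀ = 1`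
  (`transducerPeriod_sub_powK_eq_one`, `transducerK0_sub_powK_eq_one`), Prop. 3.2 in the good
  labelling at the root (`MinImage.exists_rootSumρ_le`) and the labelling transfer to plain
  outputs (`MinImage.rootAPEstimate_of_rootSumρ`, `MoebiusAutomaticRootTransfer.lean`).

* **`OperatorMauduitRivat k` and `mullner_moebius_automatic_of_operatorMauduitRivat`** — the
  SHARPER interface actually delivered by the printed Thm. 4.4. The printed bound
  `‖∑_{n≤x} μ(n) f(n) e(θn)‖ ≪ (log x)^{9/4+max(ω(k),2)/4} x k^{−ηγ(2⌊log x/(80 log k)⌋)/20}` is `o(x)`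
  only when `γ` grows faster than a multiple of `log` (Mauduit–Rivat 2015, Remark 1, (9):
  "Theorem 1 gives a non-trivial result if `lim inf γ(λ)/log λ > 20 c₂(q)/log q`"), whereas
  `MatrixMauduitRivat k` asks the `o(x)` conclusion for EVERY non-decreasing unbounded `γ`. The
  property `OperatorMauduitRivat k` adds the growth hypothesis `∀ A, A log λ ≤ γ(λ)` eventually
  (satisfied by the linear `γ(λ) = θλ − c'` of Thm. 4.5, the only case used here);
  `operatorMauduitRivat_of_matrixMauduitRivat` records the trivial implication, the §4.3 chain is
  run from `OperatorMauduitRivat k` (`MinImage.exists_expSum_good_le_op`), and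
  `mullner_moebius_automatic_of_matrixMauduitRivat` is kept as a corollary.

What remains for an unconditional proof of the named fact is exactly a proof of
`OperatorMauduitRivat k` for `k ≥ 2` (Müllner Thm. 4.4 / Mauduit–Rivat 2015 Thm. 2 for matrices,
in the qualitative form with the growth condition of Mauduit–Rivat's Remark 1).

## References
* C. Müllner, Duke Math. J. 166 (2017) = arXiv:1602.03042: Thm. 1.2, Prop. 2.25, Prop. 3.2
  (p. 15), Prop. 3.3, Thm. 4.4, Lemma 4.11 and the proof of Prop. 3.2 (pp. 22–23), Thm. 2.16,
  Lemma 2.14. [Mullner2017]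
* C. Mauduit, J. Rivat, J. Eur. Math. Soc. 17 (2015) 2595–2642, Thm. 2 and Remark 1 ((9), p. 2598).
  [MauduitRivat2015]
-/

noncomputable section

open Finset Complex
open scoped FourierTransform InnerProductSpace ArithmeticFunction.Moebius

namespace Literature.NumberTheory.LFunctions


/-! ## Residue classes from `θ`-uniform exponential sums (vector form) -/

/-- **The `θ`-uniform form implies the AP form, for vector coefficients** (expand `[n ≡ c (q)]`
into the additive characters `e(hn/q)`, `h < q`). [cite: Mullner2017, §4.3] -/
theorem exists_apSum_le_of_expSum {V : Type*} [NormedAddCommGroup V] [NormedSpace ℂ V]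
    (v : ℕ → V) (h : ∀ ε : ℝ, 0 < ε → ∃ x₀ : ℕ, ∀ x : ℕ, x₀ ≤ x → ∀ θ : ℝ,
      ‖∑ n ∈ range x, ((μ n : ℂ) * Complex.exp (2 * Real.pi * Complex.I * (θ * n))) • v n‖ ≤ ε * x)
    {q : ℕ} (hq : 0 < q) (c : ℕ) {ε : ℝ} (hε : 0 < ε) :
    ∃ x₀ : ℕ, ∀ x : ℕ, x₀ ≤ x →
      ‖∑ n ∈ (range x).filter (fun n => n % q = c), (μ n : ℂ) • v n‖ ≤ ε * x := by
  obtain ⟨x₀, hx₀⟩ := h ε hε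
  refine ⟨x₀, fun x hx => ?_⟩
  rcases le_or_gt q c with hcq | hcq
  · have : ((range x).filter fun n => n % q = c) = ∅ :=
      filter_eq_empty_iff.2 fun n _ hn => absurd hn ((Nat.mod_lt n hq).trans_le hcq).ne
    rw [this, sum_empty, norm_zero]; positivity
  have hqC : (q : ℂ) ≠ 0 := by exact_mod_cast hq.ne'
  -- expand the indicator into additive characters
  have e1 : ∀ n ∈ range x, (if n % q = c then (μ n : ℂ) • v n else 0) =
      ((q : ℂ)⁻¹ * ∑ h ∈ range q, Complex.exp (2 * Real.pi * Complex.I * (-(h * (c : ℂ) / q))) *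
        (Complex.exp (2 * Real.pi * Complex.I * ((h : ℝ) / q * n)) * (μ n : ℂ))) • v n := by
    intro n _
    rw [← ite_mod_mul_eq_sum_exp hq hcq n (μ n : ℂ)]
    split_ifs <;> simp
  have hexp : ∑ n ∈ (range x).filter (fun n => n % q = c), (μ n : ℂ) • v n =
      (q : ℂ)⁻¹ • ∑ h ∈ range q, Complex.exp (2 * Real.pi * Complex.I * (-(h * (c : ℂ) / q))) •
        ∑ n ∈ range x, ((μ n : ℂ) * Complex.exp (2 * Real.pi * Complex.I * (((h : ℝ) / q : ℝ) * n))) • v n := by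
    calc ∑ n ∈ (range x).filter (fun n => n % q = c), (μ n : ℂ) • v n
        = ∑ n ∈ range x, (if n % q = c then (μ n : ℂ) • v n else 0) := sum_filter _ _
      _ = ∑ n ∈ range x, ((q : ℂ)⁻¹ * ∑ h ∈ range q,
            Complex.exp (2 * Real.pi * Complex.I * (-(h * (c : ℂ) / q))) *
              (Complex.exp (2 * Real.pi * Complex.I * ((h : ℝ) / q * n)) * (μ n : ℂ))) • v n :=
          sum_congr rfl e1
      _ = (q : ℂ)⁻¹ • ∑ n ∈ range x, ∑ h ∈ range q,
            (Complex.exp (2 * Real.pi * Complex.I * (-(h * (c : ℂ) / q))) *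
              (Complex.exp (2 * Real.pi * Complex.I * ((h : ℝ) / q * n)) * (μ n : ℂ))) • v n := by
          rw [smul_sum]
          refine sum_congr rfl fun n _ => ?_
          rw [mul_smul, sum_smul]
      _ = (q : ℂ)⁻¹ • ∑ h ∈ range q, ∑ n ∈ range x,
            (Complex.exp (2 * Real.pi * Complex.I * (-(h * (c : ℂ) / q))) *
              (Complex.exp (2 * Real.pi * Complex.I * ((h : ℝ) / q * n)) * (μ n : ℂ))) • v n := by
          rw [sum_comm]
      _ = _ := by
          congr 1
          refine sum_congr rfl fun h _ => ?_
          rw [smul_sum]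
          refine sum_congr rfl fun n _ => ?_
          rw [smul_smul]
          congr 1
          push_cast
          ring
  rw [hexp, norm_smul, norm_inv, Complex.norm_natCast]
  calc (q : ℝ)⁻¹ * ‖∑ h ∈ range q, Complex.exp (2 * Real.pi * Complex.I * (-(h * (c : ℂ) / q))) •
        ∑ n ∈ range x, ((μ n : ℂ) * Complex.exp (2 * Real.pi * Complex.I * (((h : ℝ) / q : ℝ) * n))) • v n‖
      ≤ (q : ℝ)⁻¹ * ∑ h ∈ range q, ‖Complex.exp (2 * Real.pi * Complex.I * (-(h * (c : ℂ) / q))) •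
        ∑ n ∈ range x, ((μ n : ℂ) * Complex.exp (2 * Real.pi * Complex.I * (((h : ℝ) / q : ℝ) * n))) • v n‖ := by
        gcongr; exact norm_sum_le _ _
    _ ≤ (q : ℝ)⁻¹ * ∑ _h ∈ range q, ε * x := by
        gcongr with h _
        rw [norm_smul, norm_exp_neg_char, one_mul]
        exact hx₀ x hx ((h : ℝ) / q)
    _ = ε * x := by rw [sum_const, card_range, nsmul_eq_mul]; field_simp

/-- Norm of a value of the standard additive character. [folklore] -/
theorem norm_zmod_stdAddChar_eq_one {d : ℕ} [NeZero d] (j : ZMod d) : ‖(ZMod.stdAddChar j : ℂ)‖ = 1 := by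
  rw [ZMod.stdAddChar_apply]; exact Circle.norm_coe _

/-! ## Thm. 4.4 in operator form with the growth condition on `γ` -/

/-- **Müllner 2017, Thm. 4.4 (matrix Mauduit–Rivat estimate for `μ`), operator form, qualitative,
WITH the growth condition under which the printed bound is non-trivial — a property of the base
`k`, NOT asserted here.** Printed statement (p. 19): for `γ` non-decreasing with `γ(λ) → ∞`,
`f : ℕ → U_d` with the carry property for some `η ∈ (0,1]` and `f ∈ F_{γ,c}` for some `c ≥ 10`,
`‖∑_{n≤x} μ(n) f(n) e(θn)‖ ≪ c₁(k)(log x)^{9/4+max(ω(k),2)/4} x k^{−ηγ(2⌊(log x)/(80 log k)⌋)/20}` for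
every real `θ`. This is `o(x)` (uniformly in `θ`) as soon as `γ(λ)/log λ → ∞` (Mauduit–Rivat
2015, Remark 1, (9)); here we require `∀ A, A·log λ ≤ γ(λ)` for all large `λ`, which holds for the
linear `γ` produced by Thm. 4.5. Setting as in `MatrixMauduitRivat`: `W` a finite-dimensional
complex inner-product space, `U : G →* (W →ₗ W)` isometric, `f : ℕ → G` with the carry property
(`HasCarryProperty`, prefix-cancelling form of Def. 4.1), the Fourier property (Def. 4.2) in the
operator norm, and the conclusion `‖∑_{n<x} μ(n) e(θn) U(f(n))‖_op ≤ εx` for `x ≥ x₀(ε)`, all `θ`.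
`MatrixMauduitRivat k` (no growth condition) trivially implies it
(`operatorMauduitRivat_of_matrixMauduitRivat`). [cite: Mullner2017, Thm. 4.4]
[cite: MauduitRivat2015, Thm. 2 and Remark 1] -/
def OperatorMauduitRivat (k : ℕ) : Prop :=
  ∀ (W : Type) [NormedAddCommGroup W] [InnerProductSpace ℂ W] [FiniteDimensional ℂ W]
    (G : Type) [Group G] (f : ℕ → G) (U : G →* (W →ₗ[ℂ] W)),
    (∀ (g : G) (w : W), ‖U g w‖ = ‖w‖) →
    ∀ (η C : ℝ) (γ : ℝ → ℝ) (c : ℝ), 0 < η → η ≤ 1 → HasCarryProperty k η C f →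
      Monotone γ → (∀ A : ℝ, ∀ᶠ lam : ℝ in Filter.atTop, A * Real.log lam ≤ γ lam) → 10 ≤ c →
      MauduitRivat.HasFourierProperty k γ c (fun n => LinearMap.toContinuousLinearMap (U (f n))) →
      ∀ ε : ℝ, 0 < ε → ∃ x₀ : ℕ, ∀ x : ℕ, x₀ ≤ x → ∀ θ : ℝ,
        ‖∑ n ∈ Finset.range x, ((μ n : ℂ) * Complex.exp (2 * Real.pi * Complex.I * (θ * n))) •
          LinearMap.toContinuousLinearMap (U (f n))‖ ≤ ε * x

/-- The growth condition `∀ A, A log λ ≤ γ(λ)` eventually implies `γ(λ) → ∞`. [folklore] -/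
theorem tendsto_atTop_of_log_le {γ : ℝ → ℝ}
    (hγ : ∀ A : ℝ, ∀ᶠ lam : ℝ in Filter.atTop, A * Real.log lam ≤ γ lam) :
    Filter.Tendsto γ Filter.atTop Filter.atTop := by
  refine Filter.tendsto_atTop_mono' Filter.atTop ?_ Real.tendsto_log_atTop
  filter_upwards [hγ 1] with lam h
  simpa using h

/-- `MatrixMauduitRivat k` (all unbounded non-decreasing `γ`) implies `OperatorMauduitRivat k`
(those `γ` dominating every multiple of `log`). [folklore] -/
theorem operatorMauduitRivat_of_matrixMauduitRivat {k : ℕ} (H : MatrixMauduitRivat k) :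
    OperatorMauduitRivat k :=
  fun W _ _ _ G _ f U hU η C γ c hη hη1 hcarry hmono hγ hc hF ε hε =>
    H W G f U hU η C γ c hη hη1 hcarry hmono (tendsto_atTop_of_log_le hγ) hc hF ε hε

/-- A linear function dominates every multiple of `log`: for `θ > 0`,
`A log λ ≤ θλ − c'` for all large `λ`. [folklore] -/
theorem eventually_mul_log_le_linear {θ : ℝ} (hθ : 0 < θ) (c' A : ℝ) :
    ∀ᶠ lam : ℝ in Filter.atTop, A * Real.log lam ≤ θ * lam - c' := by
  rcases le_or_gt A 0 with hA | hA
  · filter_upwards [Filter.eventually_ge_atTop (1 : ℝ), Filter.eventually_ge_atTop (c' / θ)] with lam h1 h2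
    have hlog : 0 ≤ Real.log lam := Real.log_nonneg h1
    have h3 : c' ≤ θ * lam := by rw [div_le_iff₀ hθ] at h2; linarith
    nlinarith
  · have hε : 0 < θ / (2 * A) := by positivity
    have hbound := Real.isLittleO_log_id_atTop.bound hε
    filter_upwards [hbound, Filter.eventually_ge_atTop (0 : ℝ), Filter.eventually_ge_atTop (2 * c' / θ)]
      with lam h h0 h2
    rw [id, Real.norm_eq_abs, Real.norm_eq_abs, abs_of_nonneg h0] at h
    have hlog : Real.log lam ≤ θ / (2 * A) * lam := (le_abs_self _).trans h
    have h3 : 2 * c' ≤ θ * lam := by rw [div_le_iff₀ hθ] at h2; linarith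
    calc A * Real.log lam ≤ A * (θ / (2 * A) * lam) := mul_le_mul_of_nonneg_left hlog hA.le
      _ = θ * lam / 2 := by field_simp
      _ ≤ θ * lam - c' := by linarith

namespace MinImage

variable {σ : Type*} [Fintype σ] [DecidableEq σ] {δ : σ → ℕ → σ} {k : ℕ}

/-! ## Residues of the relabelled outputs -/

/-- **`s₀(T̄(M, w)) ≡ [w]_k + c(δ(M,w)) (mod d')`** (good labelling at `M`, `d = k₀ = 1`): the
relabelling permutation `ρ_N ∈ G_{N M}(0)` is the output of a return path `p_N : N → M`, so
`T̄(M, w) = T(M, w p_N)` is a loop and Thm. 2.16 gives its residue `[w]_k + [p_N]_k`.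
[cite: Mullner2017, Thm. 2.16 / Lemma 2.22] -/
theorem exists_residue_constants (hk : 2 ≤ k) (htriv : ∀ q d, k ≤ d → δ q d = q)
    (hd : transducerPeriod k δ = 1) (hk0 : transducerK0 hk δ htriv = 1) (M : MinImage δ) :
    ∃ cst : MinImage δ → ZMod (transducerDPrime hk δ htriv), ∀ (w : List ℕ), (∀ d ∈ w, d < k) →
      M.s0 hk htriv (M.Tρ (goodLabel (by omega : 0 < k) htriv M) w) =
        ((wordVal k w : ℕ) : ZMod (transducerDPrime hk δ htriv)) + cst (M.next w) := by
  have hk0' : 0 < k := by omega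
  obtain ⟨m, hm⟩ := exists_path_of_period_eq_one hk0' htriv hd (δ := δ)
  have hpath : ∀ N : MinImage δ, ∃ p : List ℕ, (∀ d ∈ p, d < k) ∧
      s0Level hk htriv (δ := δ) ≤ p.length ∧ N.next p = M ∧ N.T p = goodLabel hk0' htriv M N := by
    intro N
    obtain ⟨p, hpd, hpl, hpn, hpT⟩ := hm N M 0 (max m (s0Level hk htriv (δ := δ))) (le_max_left _ _) _
      (goodLabel_mem hk0' htriv M N)
    exact ⟨p, hpd, by rw [hpl]; exact le_max_right _ _, hpn, hpT⟩
  choose p hpd hpl hpn hpT using hpath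
  refine ⟨fun N => ((wordVal k (p N) : ℕ) : ZMod (transducerDPrime hk δ htriv)), fun w hwd => ?_⟩
  have hloopn : M.next (w ++ p (M.next w)) = M := by rw [next_append, hpn]
  have hdig : ∀ d ∈ w ++ p (M.next w), d < k := by
    intro d hd'
    rcases List.mem_append.1 hd' with h | h
    exacts [hwd d h, hpd _ d h]
  have hlen : s0Level hk htriv (δ := δ) ≤ (w ++ p (M.next w)).length := by
    rw [List.length_append]; exact (hpl _).trans (Nat.le_add_left _ _)
  have hres := M.natCast_wordVal_eq_s0 hk htriv hd hk0 hdig hloopn hlen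
  have hT : M.T (w ++ p (M.next w)) = M.Tρ (goodLabel hk0' htriv M) w := by
    rw [T_append, hpT, Tρ, goodLabel_self, ← Equiv.Perm.inv_def, inv_one, one_trans_eq]
  rw [hT] at hres
  rw [← hres, wordVal_append]
  push_cast
  have := natCast_pow_eq_one_of_period_eq_one hk htriv hd (p (M.next w)).length
  push_cast at this
  rw [this, mul_one]

/-! ## The `D_ℓ`-part: Lemma 4.11 -/

/-- **Lemma 4.11 (the `D_ℓ`-part), via the bad subspace.** For `b` in the bad subspace at a
state `M` (good labelling, `d = k₀ = 1`) and any `u`, `q ≥ 1`, `c`: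
`∑_{n<x, n≡c (q)} μ(n) ⟨u, R(T̄(M,(n)_k)) b⟩ = o(x)` — on the `D_ℓ`-eigenspace the coefficient is
`e(ℓ(n + c(δ(M,(n)_k)))/d') ⟨u, b⟩`, a periodic twist of a function of the end state.
[cite: Mullner2017, Lemma 4.11] -/
theorem exists_badSum_le (hk : 2 ≤ k) (htriv : ∀ q d, k ≤ d → δ q d = q)
    [NeZero (transducerDPrime hk δ htriv)] (hd : transducerPeriod k δ = 1)
    (hk0 : transducerK0 hk δ htriv = 1) (M : MinImage δ)
    {b : EuclideanSpace ℂ (Equiv.Perm (Fin (minRank δ)))}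
    (hb : b ∈ M.badSubspace hk htriv (regRep _) (goodLabel (by omega : 0 < k) htriv M))
    (u : EuclideanSpace ℂ (Equiv.Perm (Fin (minRank δ)))) {q : ℕ} (hq : 0 < q) (c : ℕ) {ε : ℝ}
    (hε : 0 < ε) :
    ∃ x₀ : ℕ, ∀ x : ℕ, x₀ ≤ x →
      ‖∑ n ∈ (range x).filter (fun n => n % q = c),
        (μ n : ℂ) * ⟪u, regRep _ (M.Tρ (goodLabel (by omega : 0 < k) htriv M) ((Nat.digits k n).reverse)) b⟫_ℂ‖ ≤
          ε * x := by
  have hk0' : 0 < k := by omega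
  obtain ⟨cst, hcst⟩ := M.exists_residue_constants hk htriv hd hk0
  -- induction over the span of the eigenspaces, for all `ε`
  revert ε
  induction hb using Submodule.iSup_induction' with
  | mem ℓ b hb =>
    intro ε hε
    -- the eigen-relation for every output `T̄(M,(n)_k)`
    have heig : ∀ n : ℕ, regRep _ (M.Tρ (goodLabel hk0' htriv M) ((Nat.digits k n).reverse)) b =
        (ZMod.stdAddChar (ℓ * (n : ZMod (transducerDPrime hk δ htriv))) *
          ZMod.stdAddChar (ℓ * cst (M.next ((Nat.digits k n).reverse)))) • b := by
      intro n
      have hg := M.Tρ_goodLabel_mem_loopGroup hk htriv hd (digits_reverse_lt hk n)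
      have h := hb _ hg
      rw [conjρ_goodLabel_self] at h
      rw [h, loopChar, hcst _ (digits_reverse_lt hk n), ← AddChar.map_add_eq_mul, mul_add]
      congr 3
      rw [wordVal, List.reverse_reverse, Nat.ofDigits_digits]
    -- the periodic weight and the end-state function
    set p : ℕ → ℂ := fun n => (if n % q = c then (1 : ℂ) else 0) *
      ZMod.stdAddChar (ℓ * (n : ZMod (transducerDPrime hk δ htriv))) with hp
    set τ : MinImage δ → ℂ := fun N => ZMod.stdAddChar (ℓ * cst N) with hτ
    have hpper : Function.Periodic p (q * transducerDPrime hk δ htriv) := by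
      intro n
      simp only [hp]
      congr 1
      · rw [Nat.add_mul_mod_self_left]
      · push_cast
        rw [ZMod.natCast_self, mul_zero, add_zero]
    have hp1 : ∀ n, ‖p n‖ ≤ 1 := fun n => by
      simp only [hp]
      rw [norm_mul, norm_zmod_stdAddChar_eq_one, mul_one]
      split_ifs <;> simp
    have hτ1 : ∀ N, ‖τ N‖ ≤ 1 := fun N => (norm_zmod_stdAddChar_eq_one _).le
    have hqd : 0 < q * transducerDPrime hk δ htriv := Nat.mul_pos hq (Nat.pos_of_ne_zero (NeZero.ne _))
    obtain ⟨x₀, hx₀⟩ := M.exists_forall_norm_twistedSum_le hk htriv hτ1 hpper hqd hp1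
      (ε := ε / (‖⟪u, b⟫_ℂ‖ + 1)) (by positivity)
    refine ⟨x₀, fun x hx => ?_⟩
    have hrew : ∑ n ∈ (range x).filter (fun n => n % q = c),
        (μ n : ℂ) * ⟪u, regRep _ (M.Tρ (goodLabel hk0' htriv M) ((Nat.digits k n).reverse)) b⟫_ℂ =
        ⟪u, b⟫_ℂ * ∑ n ∈ range x, p n * τ (M.next ((Nat.digits k n).reverse)) * (μ n : ℂ) := by
      rw [sum_filter, mul_sum]
      refine sum_congr rfl fun n _ => ?_
      rw [heig n, inner_smul_right]
      simp only [hp, hτ]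
      split_ifs <;> ring
    rw [hrew, norm_mul]
    have hfrac : ‖⟪u, b⟫_ℂ‖ / (‖⟪u, b⟫_ℂ‖ + 1) ≤ 1 := by
      rw [div_le_one (by positivity)]; linarith
    calc ‖⟪u, b⟫_ℂ‖ * ‖∑ n ∈ range x, p n * τ (M.next ((Nat.digits k n).reverse)) * (μ n : ℂ)‖
        ≤ ‖⟪u, b⟫_ℂ‖ * (ε / (‖⟪u, b⟫_ℂ‖ + 1) * x) :=
          mul_le_mul_of_nonneg_left (hx₀ x hx) (norm_nonneg _)
      _ = (‖⟪u, b⟫_ℂ‖ / (‖⟪u, b⟫_ℂ‖ + 1)) * (ε * x) := by ring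
      _ ≤ 1 * (ε * x) := mul_le_mul_of_nonneg_right hfrac (by positivity)
      _ = ε * x := one_mul _
  | zero =>
    intro ε hε
    refine ⟨0, fun x _ => ?_⟩
    simp only [map_zero, inner_zero_right, mul_zero, sum_const_zero, norm_zero]
    positivity
  | add b b' _ _ ihb ihb' =>
    intro ε hε
    obtain ⟨x₁, hx₁⟩ := ihb (half_pos hε)
    obtain ⟨x₂, hx₂⟩ := ihb' (half_pos hε)
    refine ⟨max x₁ x₂, fun x hx => ?_⟩
    have e : ∑ n ∈ (range x).filter (fun n => n % q = c),
        (μ n : ℂ) * ⟪u, regRep _ (M.Tρ (goodLabel hk0' htriv M) ((Nat.digits k n).reverse)) (b + b')⟫_ℂ =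
        ∑ n ∈ (range x).filter (fun n => n % q = c),
          (μ n : ℂ) * ⟪u, regRep _ (M.Tρ (goodLabel hk0' htriv M) ((Nat.digits k n).reverse)) b⟫_ℂ +
        ∑ n ∈ (range x).filter (fun n => n % q = c),
          (μ n : ℂ) * ⟪u, regRep _ (M.Tρ (goodLabel hk0' htriv M) ((Nat.digits k n).reverse)) b'⟫_ℂ := by
      rw [← sum_add_distrib]
      refine sum_congr rfl fun n _ => ?_
      rw [map_add, inner_add_right, mul_add]
    rw [e]
    calc _ ≤ _ := norm_add_le _ _
      _ ≤ ε / 2 * x + ε / 2 * x :=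
          add_le_add (hx₁ x ((le_max_left _ _).trans hx)) (hx₂ x ((le_max_right _ _).trans hx))
      _ = ε * x := by ring

/-! ## The other representations: Thm. 4.4 on the good subspace -/

/-- **Müllner §4.3 on good vectors, from `OperatorMauduitRivat k`**: Thm. 4.4 applied to
`R(T̄(M,(n)_k))|_W` — for every zero-stable state `M` (`d = k₀ = 1`, good labelling), every `y` in
the good subspace at `M` and every `ε > 0`, for all large `x` and ALL real `θ`,
`‖∑_{n<x} μ(n) e(θn) R(T̄(M,(n)_k)) y‖ ≤ ε x ‖y‖`. (Same proof as `exists_expSum_good_le` in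
`MoebiusAutomaticRegularRep.lean`; the Fourier property of Thm. 4.5 has the LINEAR
`γ(λ) = θλ − log_k C`, which dominates every multiple of `log`.)
[cite: Mullner2017, §4.3 (proof of Prop. 3.2)] -/
theorem exists_expSum_good_le_op (H : OperatorMauduitRivat k) (hk : 2 ≤ k)
    (htriv : ∀ q d, k ≤ d → δ q d = q) [NeZero (transducerDPrime hk δ htriv)]
    (hd : transducerPeriod k δ = 1) (hk0 : transducerK0 hk δ htriv = 1) (M : MinImage δ)
    (h0 : M.next [0] = M) (h1 : M.T [0] = 1) {ε : ℝ} (hε : 0 < ε) :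
    ∃ x₀ : ℕ, ∀ x : ℕ, x₀ ≤ x → ∀ θ : ℝ,
      ∀ y ∈ M.goodSubspace hk htriv (regRep _) (goodLabel (by omega : 0 < k) htriv M),
        ‖∑ n ∈ range x, ((μ n : ℂ) * Complex.exp (2 * Real.pi * Complex.I * (θ * n))) •
            regRep _ (M.Tρ (goodLabel (by omega : 0 < k) htriv M) ((Nat.digits k n).reverse)) y‖ ≤
          ε * x * ‖y‖ := by
  have hk0' : 0 < k := by omega
  -- carry property
  obtain ⟨η, hη0, hη1, C₁, hC₁⟩ := hasCarryProperty_goodSeq (δ := δ) hk htriv hd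
  -- Fourier property
  obtain ⟨C, θ, hC, hθ, h45⟩ :=
    exists_fourier_decay_digits hk htriv hd hk0 (regRep _) norm_regRep (goodLabel hk0' htriv M)
  have hF := hasFourierProperty_goodRep hk htriv hd hk0 hC (h45 M h0 h1) 10
  -- the function `γ`
  have hmono : Monotone (fun lam : ℝ => θ * lam - Real.logb k C) := fun a b hab => by
    simp only; nlinarith
  have hγ : ∀ A : ℝ, ∀ᶠ lam : ℝ in Filter.atTop, A * Real.log lam ≤ θ * lam - Real.logb k C :=
    fun A => eventually_mul_log_le_linear hθ _ A
  obtain ⟨x₀, hx₀⟩ := H _ _ (M.goodSeq hk htriv hd) (M.goodRep hk htriv hd hk0)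
    (M.norm_goodRep hk htriv hd hk0) η C₁ _ 10 hη0 hη1 (hC₁ M h0 h1) hmono hγ le_rfl hF ε hε
  refine ⟨x₀, fun x hx θ' y hy => ?_⟩
  have hop := hx₀ x hx θ'
  set T : ↥(M.goodSubspace hk htriv (regRep _) (goodLabel hk0' htriv M)) →L[ℂ]
      ↥(M.goodSubspace hk htriv (regRep _) (goodLabel hk0' htriv M)) :=
    ∑ n ∈ range x, ((μ n : ℂ) * Complex.exp (2 * Real.pi * Complex.I * (θ' * n))) •
      LinearMap.toContinuousLinearMap (M.goodRep hk htriv hd hk0 (M.goodSeq hk htriv hd n)) with hT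
  have hTy : ((T ⟨y, hy⟩ : ↥(M.goodSubspace hk htriv (regRep _) (goodLabel hk0' htriv M))) :
      EuclideanSpace ℂ (Equiv.Perm (Fin (minRank δ)))) =
      ∑ n ∈ range x, ((μ n : ℂ) * Complex.exp (2 * Real.pi * Complex.I * (θ' * n))) •
        regRep _ (M.Tρ (goodLabel hk0' htriv M) ((Nat.digits k n).reverse)) y := by
    rw [hT, _root_.sum_apply, Submodule.coe_sum]
    refine Finset.sum_congr rfl fun n _ => ?_
    rw [FunLike.coe_smul, Pi.smul_apply, Submodule.coe_smul, LinearMap.coe_toContinuousLinearMap',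
      coe_goodRep_apply, coe_goodSeq]
  have hle := (T.le_opNorm ⟨y, hy⟩).trans (mul_le_mul_of_nonneg_right hop (norm_nonneg _))
  rw [Submodule.coe_norm, Submodule.coe_norm, hTy] at hle
  exact hle

/-- **The good part in residue classes**: assuming `OperatorMauduitRivat k`, for a zero-stable `M`
and `y` in the good subspace, `‖∑_{n<x, n≡c (q)} μ(n) R(T̄(M,(n)_k)) y‖ ≤ ε x` for large `x`.
[cite: Mullner2017, §4.3 (proof of Prop. 3.2)] -/
theorem exists_goodSum_le (H : OperatorMauduitRivat k) (hk : 2 ≤ k)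
    (htriv : ∀ q d, k ≤ d → δ q d = q) [NeZero (transducerDPrime hk δ htriv)]
    (hd : transducerPeriod k δ = 1) (hk0 : transducerK0 hk δ htriv = 1) (M : MinImage δ)
    (h0 : M.next [0] = M) (h1 : M.T [0] = 1)
    {y : EuclideanSpace ℂ (Equiv.Perm (Fin (minRank δ)))}
    (hy : y ∈ M.goodSubspace hk htriv (regRep _) (goodLabel (by omega : 0 < k) htriv M))
    {q : ℕ} (hq : 0 < q) (c : ℕ) {ε : ℝ} (hε : 0 < ε) :
    ∃ x₀ : ℕ, ∀ x : ℕ, x₀ ≤ x →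
      ‖∑ n ∈ (range x).filter (fun n => n % q = c),
        (μ n : ℂ) • regRep _ (M.Tρ (goodLabel (by omega : 0 < k) htriv M) ((Nat.digits k n).reverse)) y‖ ≤
          ε * x := by
  refine exists_apSum_le_of_expSum
    (fun n => regRep _ (M.Tρ (goodLabel (by omega : 0 < k) htriv M) ((Nat.digits k n).reverse)) y)
    (fun ε' hε' => ?_) hq c hε
  obtain ⟨x₀, hx₀⟩ := M.exists_expSum_good_le_op H hk htriv hd hk0 h0 h1 (ε := ε' / (‖y‖ + 1)) (by positivity)
  refine ⟨x₀, fun x hx θ => (hx₀ x hx θ y hy).trans ?_⟩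
  have hfrac : ‖y‖ / (‖y‖ + 1) ≤ 1 := by
    rw [div_le_one (by positivity)]; linarith
  calc ε' / (‖y‖ + 1) * x * ‖y‖ = (‖y‖ / (‖y‖ + 1)) * (ε' * x) := by ring
    _ ≤ 1 * (ε' * x) := mul_le_mul_of_nonneg_right hfrac (by positivity)
    _ = ε' * x := one_mul _

/-! ## Prop. 3.2 at the root, relabelled form -/

/-- **Müllner's Prop. 3.2 at a zero-stable root, for the relabelled outputs, from Thm. 4.4.**
Let `k ≥ 2`, `δ` a base-`k` automaton (letters `≥ k` trivial) with `d = k₀ = 1`, `M` a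
zero-stable state of its naturally induced transducer and `T̄ = Tρ (goodLabel M)` the outputs in
the good labelling rooted at `M`. If `OperatorMauduitRivat k` (Thm. 4.4) holds, then for every
output `π`, modulus `q ≥ 1`, residue `c` and `ε > 0`, for all large `x`,
`|∑_{n<x, n≡c (q), T̄(M,(n)_k) = π} μ(n)| ≤ ε x`. Proof (§4.3): `[g = π] = ⟨δ_π, R(g)δ_1⟩` in the
regular representation; `δ_1 = y₀ + b` with `y₀` good and `b` bad; the good part by Thm. 4.4
with Lemma 4.10 and Thm. 4.5 (`exists_goodSum_le`), the bad part by Lemma 4.11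
(`exists_badSum_le`). [cite: Mullner2017, Prop. 3.2 and §4.3] -/
theorem exists_rootSumρ_le (H : OperatorMauduitRivat k) (hk : 2 ≤ k)
    (htriv : ∀ q d, k ≤ d → δ q d = q) [NeZero (transducerDPrime hk δ htriv)]
    (hd : transducerPeriod k δ = 1) (hk0 : transducerK0 hk δ htriv = 1) (M : MinImage δ)
    (h0 : M.next [0] = M) (h1 : M.T [0] = 1) (π : Equiv.Perm (Fin (minRank δ))) {q : ℕ} (hq : 0 < q)
    (c : ℕ) {ε : ℝ} (hε : 0 < ε) :
    ∃ x₀ : ℕ, ∀ x : ℕ, x₀ ≤ x →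
      ‖∑ n ∈ (range x).filter (fun n => n % q = c ∧
          M.Tρ (goodLabel (by omega : 0 < k) htriv M) ((Nat.digits k n).reverse) = π), (μ n : ℂ)‖ ≤ ε * x := by
  classical
  have hk0' : 0 < k := by omega
  set W := M.goodSubspace hk htriv (regRep _) (goodLabel hk0' htriv M) with hW
  set δ₁ : EuclideanSpace ℂ (Equiv.Perm (Fin (minRank δ))) := EuclideanSpace.single 1 1 with hδ₁
  set u : EuclideanSpace ℂ (Equiv.Perm (Fin (minRank δ))) := EuclideanSpace.single π 1 with hu
  -- orthogonal decomposition of `δ_1`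
  obtain ⟨y₀, hy₀, b, hb, hdec⟩ := Submodule.exists_add_mem_mem_orthogonal (K := W) δ₁
  have hb' : b ∈ M.badSubspace hk htriv (regRep _) (goodLabel hk0' htriv M) := by
    rwa [hW, goodSubspace, Submodule.orthogonal_orthogonal] at hb
  obtain ⟨x₁, hx₁⟩ := M.exists_goodSum_le H hk htriv hd hk0 h0 h1 hy₀ hq c (half_pos hε)
  obtain ⟨x₂, hx₂⟩ := M.exists_badSum_le hk htriv hd hk0 hb' u hq c (half_pos hε)
  refine ⟨max x₁ x₂, fun x hx => ?_⟩
  -- the indicator as a matrix coefficient, split along `δ_1 = y₀ + b`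
  have hsum : ∑ n ∈ (range x).filter (fun n => n % q = c ∧
      M.Tρ (goodLabel hk0' htriv M) ((Nat.digits k n).reverse) = π), (μ n : ℂ) =
      ⟪u, ∑ n ∈ (range x).filter (fun n => n % q = c),
        (μ n : ℂ) • regRep _ (M.Tρ (goodLabel hk0' htriv M) ((Nat.digits k n).reverse)) y₀⟫_ℂ +
      ∑ n ∈ (range x).filter (fun n => n % q = c),
        (μ n : ℂ) * ⟪u, regRep _ (M.Tρ (goodLabel hk0' htriv M) ((Nat.digits k n).reverse)) b⟫_ℂ := by
    rw [← filter_filter, sum_filter, inner_sum, ← sum_add_distrib]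
    refine sum_congr rfl fun n _ => ?_
    rw [inner_smul_right, ← mul_add, ← inner_add_right, ← map_add, ← hdec, hu, hδ₁,
      inner_single_regRep_single]
    split_ifs <;> simp
  rw [hsum]
  have hu1 : ‖u‖ = 1 := by simp [hu]
  calc _ ≤ ‖⟪u, ∑ n ∈ (range x).filter (fun n => n % q = c),
          (μ n : ℂ) • regRep _ (M.Tρ (goodLabel hk0' htriv M) ((Nat.digits k n).reverse)) y₀⟫_ℂ‖ +
        ‖∑ n ∈ (range x).filter (fun n => n % q = c),
          (μ n : ℂ) * ⟪u, regRep _ (M.Tρ (goodLabel hk0' htriv M) ((Nat.digits k n).reverse)) b⟫_ℂ‖ :=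
        norm_add_le _ _
    _ ≤ ‖u‖ * ‖∑ n ∈ (range x).filter (fun n => n % q = c),
          (μ n : ℂ) • regRep _ (M.Tρ (goodLabel hk0' htriv M) ((Nat.digits k n).reverse)) y₀‖ +
        ε / 2 * x := add_le_add (norm_inner_le_norm _ _) (hx₂ x ((le_max_right _ _).trans hx))
    _ ≤ 1 * (ε / 2 * x) + ε / 2 * x := by
        gcongr
        · exact hu1.le
        · exact hx₁ x ((le_max_left _ _).trans hx)
    _ = ε * x := by ring

end MinImage

/-! ## The assembly of Thm. 1.2 -/


/-- **The power automaton only reads digits**: `powδ k p δ = powδ k p (digitRestrict k δ)`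
(`1 < k`; the blocks `(D)_k^p` consist of digits `< k`). [folklore] -/
theorem powδ_digitRestrict {σ : Type*} {k : ℕ} (hk : 1 < k) (p : ℕ) (δ : σ → ℕ → σ) :
    powδ k p δ = powδ k p (digitRestrict k δ) := by
  funext q D
  show wordAct δ (msbBlock k p D) q = wordAct (digitRestrict k δ) (msbBlock k p D) q
  exact (wordAct_digitRestrict δ (fun d hd => lt_of_mem_msbBlock hk hd) q).symm

/-- **Müllner 2017, Thm. 1.2 (case `ξ = a`) from Thm. 4.4 (operator form with the growth
condition).** If `OperatorMauduitRivat k` holds for every base `k ≥ 2`, then every automatic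
sequence is orthogonal to the Möbius function: `mullner_moebius_automatic`. Chain:
`mullner_moebius_automatic_of_rootAPEstimate_zeroStable` (Prop. 3.3, Prop. 2.25, zero-stable
roots) with `p = |σ|!·d(A)k₀(A)` (components with `d = k₀ = 1`),
`MinImage.rootAPEstimate_of_rootSumρ` (labelling), `MinImage.exists_rootSumρ_le` (Prop. 3.2 via
§4.3: Thm. 4.4 assumed; Thm. 4.5, Lemmas 4.10, 4.11 proved).
[cite: Mullner2017, Thm. 1.2 via Prop. 3.3, Prop. 3.2, Thm. 4.4] -/
theorem mullner_moebius_automatic_of_operatorMauduitRivat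
    (H : ∀ k : ℕ, 2 ≤ k → OperatorMauduitRivat k) : mullner_moebius_automatic := by
  classical
  refine mullner_moebius_automatic_of_rootAPEstimate_zeroStable fun k hk σ _ _ δ q₀ _ => ?_
  have hk1 : 1 < k := hk
  -- the digit-restricted automaton and the exponent `p = |σ|! · d · k₀`
  set δh : σ → ℕ → σ := digitRestrict k δ with hδh
  have htrivh : ∀ q d, k ≤ d → δh q d = q := digitRestrict_trivial k δ
  set d₀ := transducerPeriod k δh with hd₀
  set κ := transducerK0 hk δh htrivh with hκ
  set p := (Fintype.card σ).factorial * (d₀ * κ) with hp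
  have hd₀pos : 0 < d₀ := transducerPeriod_pos (by omega) htrivh
  have hκpos : 0 < κ := transducerK0_pos hk δh htrivh
  have hp0 : 0 < p := Nat.mul_pos (Nat.factorial_pos _) (Nat.mul_pos hd₀pos hκpos)
  have hdp : transducerPeriod k δh ∣ p := ⟨(Fintype.card σ).factorial * κ, by simp only [hp]; ring⟩
  have hkp : transducerPeriod k δh * transducerK0 hk δh htrivh ∣ p := Dvd.intro_left _ rfl
  have hK : 2 ≤ k ^ p := by
    calc 2 ≤ k := hk
      _ = k ^ 1 := (pow_one k).symm
      _ ≤ k ^ p := Nat.pow_le_pow_right (by omega) hp0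
  refine ⟨p, hp0, dvd_mul_right _ _, ?_⟩
  -- pass to the power automaton of the digit-restricted automaton
  have hpow : powδ k p δ = powδ k p δh := powδ_digitRestrict hk1 p δ
  suffices key : ∀ (Δ : σ → ℕ → σ), Δ = powδ k p δh →
      ∀ q ∈ finalStates (digitRestrict (k ^ p) Δ),
        ∀ Mr : MinImage (restrictδ (digitRestrict (k ^ p) Δ) (reach (digitRestrict (k ^ p) Δ) q)
          (reach_closed (digitRestrict (k ^ p) Δ) q)),
          Mr.next [0] = Mr → Mr.T [0] = 1 →
            RootAPEstimate (k ^ p) (restrictδ (digitRestrict (k ^ p) Δ)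
              (reach (digitRestrict (k ^ p) Δ) q) (reach_closed (digitRestrict (k ^ p) Δ) q)) Mr from
    key (powδ k p δ) hpow
  rintro Δ rfl q hq Mr hz0 hz1
  -- the component has `d = k₀ = 1`
  have htrivC := sub_powK_trivial k p δh (reach (digitRestrict (k ^ p) (powδ k p δh)) q)
    (reach_closed (digitRestrict (k ^ p) (powδ k p δh)) q)
  have hdC := transducerPeriod_sub_powK_eq_one hk hp0 δh htrivh hdp
    (reach (digitRestrict (k ^ p) (powδ k p δh)) q) (reach_closed (digitRestrict (k ^ p) (powδ k p δh)) q)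
  have hk0C := transducerK0_sub_powK_eq_one hk hp0 δh htrivh hK hdp hkp
    (reach (digitRestrict (k ^ p) (powδ k p δh)) q) (reach_closed (digitRestrict (k ^ p) (powδ k p δh)) q)
  haveI := transducerDPrime_neZero hK
    (restrictδ (digitRestrict (k ^ p) (powδ k p δh)) (reach (digitRestrict (k ^ p) (powδ k p δh)) q)
      (reach_closed (digitRestrict (k ^ p) (powδ k p δh)) q)) htrivC
  -- Prop. 3.2 in the good labelling at the root, then the transfer to plain outputs
  exact Mr.rootAPEstimate_of_rootSumρ hK htrivC (MinImage.goodLabel (by omega : 0 < k ^ p) htrivC Mr)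
    (MinImage.goodLabel_self _ _ _) fun π q' hq' c ε hε =>
      Mr.exists_rootSumρ_le (H (k ^ p) hK) hK htrivC hdC hk0C hz0 hz1 π hq' c hε

/-- **Müllner 2017, Thm. 1.2 (case `ξ = a`) from `MatrixMauduitRivat`** (the earlier, stronger
interface without growth condition): a corollary of
`mullner_moebius_automatic_of_operatorMauduitRivat`.
[cite: Mullner2017, Thm. 1.2 via Prop. 3.3, Prop. 3.2, Thm. 4.4] -/
theorem mullner_moebius_automatic_of_matrixMauduitRivat
    (H : ∀ k : ℕ, 2 ≤ k → MatrixMauduitRivat k) : mullner_moebius_automatic :=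
  mullner_moebius_automatic_of_operatorMauduitRivat fun k hk =>
    operatorMauduitRivat_of_matrixMauduitRivat (H k hk)

end Literature.NumberTheory.LFunctions
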